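import Mathlib.Analysis.SpecialFunctions.Pow.Asymptotics
import Mathlib.Analysis.SpecificLimits.Basic
import Mathlib.Topology.Algebra.InfiniteSum.Real
import Summits.CriticalPhenomena.Ising3DConformalLimit.Theorems.ExistsScaleCovariantLimit.Negative.DyadicTwoPrimesDensity
import HarnessLib

/-!
# Two-base Croft lemma for real sequences

Stub `stub_twoBaseCroft` (A) of line `Sketch` for the crux `JoiningsTransfer`
(item stmt-CriticalPhenomena-18764, route SynchronousCoupling, sub-problem
CriticalPhenomena/Ising3DConformalLimit).  Pure real analysis, Mathlib only, plus the landed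
density lemma `dense_closure_log_two_log_three` (`ℤ log 2 + ℤ log 3` is dense in `ℝ`).

Statement.  Let `R : ℕ → ℝ` have base-uniform tower rates at the primes `2` and `3`,
`|R (2L) - R L| ≤ C L^{-θ}` and `|R (3L) - R L| ≤ C L^{-θ}` for all `L ≥ 1` (one `C`, one `θ > 0`),
and be log-continuous: for every `ε > 0` there are `s > 0` and `L₀` with `|R L' - R L| ≤ ε`
whenever `L₀ ≤ L ≤ L' ≤ (1+s) L`.  Then `R` converges.

Proof.  The tower limit `Φ L := lim_j R (2^j L)` exists for `L ≥ 1` (geometric Cauchy bound) with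
`|Φ L - R L| ≤ C' L^{-θ}`; `Φ (2L) = Φ L` (shifted tower) and `Φ (3L) = Φ L` (the constant
`Φ (3L) - Φ L = Φ (3·2^j L) - Φ (2^j L)` tends to `0`); `Φ` inherits log-continuity at all scales
`≥ 1`; by density of `ℤ log 2 + ℤ log 3` any two scales `L, L' ≥ 1` have multiples `2^a 3^b L`,
`2^c 3^e L'` within a factor `1+s` of each other, hence `Φ` is constant `= M` on `L ≥ 1`;
finally `|R L - M| ≤ C' L^{-θ} → 0`.  [folklore]
-/

noncomputable section

namespace Summit.CriticalPhenomena.Ising3DConformalLimit.Cruxes.JoiningsTransfer.Sketch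

open Filter Set
open scoped Topology

/-- Tower limit along `j ↦ 2^j L` from the base-uniform `2`-rate, with the geometric tail bound
`|lim - R L| ≤ C / (1 - 2^{-θ}) · L^{-θ}`. [folklore] -/
private theorem stub_twoBaseCroft_tower (R : ℕ → ℝ) (C θ : ℝ) (hθ : 0 < θ)
    (h2 : ∀ L : ℕ, 1 ≤ L → |R (2 * L) - R L| ≤ C * (L : ℝ) ^ (-θ)) (L : ℕ) (hL : 1 ≤ L) :
    ∃ a : ℝ, Tendsto (fun j : ℕ => R (2 ^ j * L)) atTop (𝓝 a) ∧
      |a - R L| ≤ C / (1 - (2:ℝ) ^ (-θ)) * (L : ℝ) ^ (-θ) := by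
  have hr1 : (2:ℝ) ^ (-θ) < 1 :=
    Real.rpow_lt_one_of_one_lt_of_neg one_lt_two (neg_lt_zero.2 hθ)
  have hu : ∀ j : ℕ, dist (R (2 ^ j * L)) (R (2 ^ (j + 1) * L)) ≤
      C * (L : ℝ) ^ (-θ) * ((2:ℝ) ^ (-θ)) ^ j := by
    intro j
    have hjL : 1 ≤ 2 ^ j * L := Nat.mul_pos (Nat.pow_pos (by norm_num)) hL
    have h := h2 (2 ^ j * L) hjL
    have e1 : 2 * (2 ^ j * L) = 2 ^ (j + 1) * L := by ring
    have e2 : ((2 ^ j * L : ℕ) : ℝ) ^ (-θ) = ((2:ℝ) ^ (-θ)) ^ j * (L : ℝ) ^ (-θ) := by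
      push_cast
      rw [Real.mul_rpow (by positivity) (by positivity),
        Real.rpow_pow_comm (by norm_num : (0:ℝ) ≤ 2)]
    rw [e1, e2] at h
    rw [Real.dist_eq, abs_sub_comm]
    calc |R (2 ^ (j + 1) * L) - R (2 ^ j * L)|
        ≤ C * (((2:ℝ) ^ (-θ)) ^ j * (L : ℝ) ^ (-θ)) := h
      _ = C * (L : ℝ) ^ (-θ) * ((2:ℝ) ^ (-θ)) ^ j := by ring
  obtain ⟨a, ha⟩ := cauchySeq_tendsto_of_complete
    (cauchySeq_of_le_geometric ((2:ℝ) ^ (-θ)) (C * (L : ℝ) ^ (-θ)) hr1 hu)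
  refine ⟨a, ha, ?_⟩
  have hd := dist_le_of_le_geometric_of_tendsto₀ ((2:ℝ) ^ (-θ)) (C * (L : ℝ) ^ (-θ)) hr1 hu ha
  rw [pow_zero, one_mul, Real.dist_eq, abs_sub_comm] at hd
  calc |a - R L| ≤ C * (L : ℝ) ^ (-θ) / (1 - (2:ℝ) ^ (-θ)) := hd
    _ = C / (1 - (2:ℝ) ^ (-θ)) * (L : ℝ) ^ (-θ) := by ring

/-- Shift invariance of the tower limit: `Φ (2L) = Φ L`, because the tower over `2L` is the shifted
tower over `L`. [folklore] -/
private theorem stub_twoBaseCroft_two (R Φ : ℕ → ℝ)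
    (hΦ : ∀ L : ℕ, 1 ≤ L → Tendsto (fun j : ℕ => R (2 ^ j * L)) atTop (𝓝 (Φ L)))
    (L : ℕ) (hL : 1 ≤ L) : Φ (2 * L) = Φ L := by
  have h1 : Tendsto (fun j : ℕ => R (2 ^ (j + 1) * L)) atTop (𝓝 (Φ L)) :=
    (hΦ L hL).comp (tendsto_add_atTop_nat 1)
  have h2 : Tendsto (fun j : ℕ => R (2 ^ (j + 1) * L)) atTop (𝓝 (Φ (2 * L))) := by
    refine (hΦ (2 * L) (by omega)).congr fun j => ?_
    show R (2 ^ j * (2 * L)) = R (2 ^ (j + 1) * L)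
    congr 1
    ring
  exact tendsto_nhds_unique h2 h1

/-- Iterating a one-step invariance `Φ (kL) = Φ L` along powers of `k`. [folklore] -/
private theorem stub_twoBaseCroft_iter (Φ : ℕ → ℝ) (k : ℕ) (hk : 1 ≤ k)
    (h : ∀ L : ℕ, 1 ≤ L → Φ (k * L) = Φ L) (j L : ℕ) (hL : 1 ≤ L) :
    Φ (k ^ j * L) = Φ L := by
  induction j with
  | zero => rw [pow_zero, one_mul]
  | succ j ih =>
    have h1 : 1 ≤ k ^ j * L := Nat.mul_pos (Nat.pow_pos hk) hL
    rw [pow_succ, show k ^ j * k * L = k * (k ^ j * L) by ring, h _ h1, ih]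

/-- The tower of scales `2^j L` tends to infinity (`L ≥ 1`). [folklore] -/
private theorem stub_twoBaseCroft_tendsto_tower (L : ℕ) (hL : 1 ≤ L) :
    Tendsto (fun j : ℕ => 2 ^ j * L) atTop atTop :=
  tendsto_atTop_mono
    (fun j => j.lt_two_pow_self.le.trans (Nat.le_mul_of_pos_right _ hL)) tendsto_id

/-- Exact `3`-invariance of the tower limit from a mere `3`-rate: the constant `Φ (3L) - Φ L`
equals `Φ (3·2^j L) - Φ (2^j L)`, which tends to `0`. [folklore] -/
private theorem stub_twoBaseCroft_three (R Φ : ℕ → ℝ) (C C' θ : ℝ) (hθ : 0 < θ)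
    (h3 : ∀ L : ℕ, 1 ≤ L → |R (3 * L) - R L| ≤ C * (L : ℝ) ^ (-θ))
    (hΦb : ∀ L : ℕ, 1 ≤ L → |Φ L - R L| ≤ C' * (L : ℝ) ^ (-θ))
    (hΦ2 : ∀ L : ℕ, 1 ≤ L → Φ (2 * L) = Φ L) (L : ℕ) (hL : 1 ≤ L) :
    Φ (3 * L) = Φ L := by
  -- the difference `Φ (3m) - Φ m` tends to zero as `m → ∞`
  have h0 : Tendsto (fun m : ℕ => (m : ℝ) ^ (-θ)) atTop (𝓝 0) :=
    (tendsto_rpow_neg_atTop hθ).comp tendsto_natCast_atTop_atTop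
  have h0' : Tendsto (fun m : ℕ => ((3 * m : ℕ) : ℝ) ^ (-θ)) atTop (𝓝 0) :=
    h0.comp (tendsto_atTop_mono (fun m => Nat.le_mul_of_pos_left m (by norm_num)) tendsto_id)
  have hg : Tendsto (fun m : ℕ => C' * ((3 * m : ℕ) : ℝ) ^ (-θ) + C * (m : ℝ) ^ (-θ)
      + C' * (m : ℝ) ^ (-θ)) atTop (𝓝 0) := by
    have h := ((h0'.const_mul C').add (h0.const_mul C)).add (h0.const_mul C')
    rw [mul_zero, mul_zero, add_zero, add_zero] at h
    exact h
  have hdiff : Tendsto (fun m : ℕ => Φ (3 * m) - Φ m) atTop (𝓝 0) := by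
    refine squeeze_zero_norm' ?_ hg
    filter_upwards [eventually_ge_atTop 1] with m hm
    rw [Real.norm_eq_abs]
    have e1 := hΦb (3 * m) (by omega)
    have e2 := h3 m hm
    have e3 := hΦb m hm
    rw [abs_sub_comm] at e3
    have t1 := abs_sub_le (Φ (3 * m)) (R (3 * m)) (Φ m)
    have t2 := abs_sub_le (R (3 * m)) (R m) (Φ m)
    linarith
  -- along the tower `2^j L` the difference is the constant `Φ (3L) - Φ L`
  have hseq : Tendsto (fun _ : ℕ => Φ (3 * L) - Φ L) atTop (𝓝 0) := by
    refine (hdiff.comp (stub_twoBaseCroft_tendsto_tower L hL)).congr fun j => ?_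
    show Φ (3 * (2 ^ j * L)) - Φ (2 ^ j * L) = Φ (3 * L) - Φ L
    rw [show 3 * (2 ^ j * L) = 2 ^ j * (3 * L) by ring,
      stub_twoBaseCroft_iter Φ 2 (by norm_num) hΦ2 j (3 * L) (by omega),
      stub_twoBaseCroft_iter Φ 2 (by norm_num) hΦ2 j L hL]
  exact sub_eq_zero.1 (tendsto_const_nhds_iff.1 hseq)

/-- Log-continuity passes to the tower limit, at all scales `≥ 1`. [folklore] -/
private theorem stub_twoBaseCroft_cont (R Φ : ℕ → ℝ)
    (hΦ : ∀ L : ℕ, 1 ≤ L → Tendsto (fun j : ℕ => R (2 ^ j * L)) atTop (𝓝 (Φ L)))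
    (hcont : ∀ ε : ℝ, 0 < ε → ∃ s : ℝ, 0 < s ∧ ∃ L₀ : ℕ, ∀ L L' : ℕ, L₀ ≤ L → L ≤ L' →
      (L' : ℝ) ≤ (1 + s) * L → |R L' - R L| ≤ ε) (ε : ℝ) (hε : 0 < ε) :
    ∃ s : ℝ, 0 < s ∧ ∀ L L' : ℕ, 1 ≤ L → L ≤ L' → (L' : ℝ) ≤ (1 + s) * L →
      |Φ L' - Φ L| ≤ ε := by
  obtain ⟨s, hs, L₀, h⟩ := hcont ε hε
  refine ⟨s, hs, fun L L' hL hLL' hs' => ?_⟩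
  have hlim : Tendsto (fun j : ℕ => |R (2 ^ j * L') - R (2 ^ j * L)|) atTop
      (𝓝 (|Φ L' - Φ L|)) :=
    ((hΦ L' (hL.trans hLL')).sub (hΦ L hL)).abs
  refine le_of_tendsto hlim ?_
  filter_upwards [eventually_ge_atTop L₀] with j hj
  refine h (2 ^ j * L) (2 ^ j * L') ?_ (Nat.mul_le_mul_left _ hLL') ?_
  · calc L₀ ≤ j := hj
      _ ≤ 2 ^ j := j.lt_two_pow_self.le
      _ ≤ 2 ^ j * L := Nat.le_mul_of_pos_right _ hL
  · push_cast
    calc (2:ℝ) ^ j * (L' : ℝ) ≤ 2 ^ j * ((1 + s) * L) :=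
          mul_le_mul_of_nonneg_left hs' (by positivity)
      _ = (1 + s) * (2 ^ j * L) := by ring

/-- Every integer is a difference of two naturals (cast to `ℝ`). [folklore] -/
private theorem stub_twoBaseCroft_int_split (p : ℤ) :
    ∃ a c : ℕ, (p : ℝ) = (a : ℝ) - (c : ℝ) := by
  refine ⟨p.toNat, (-p).toNat, ?_⟩
  have h := congrArg (Int.cast : ℤ → ℝ) (Int.toNat_sub_toNat_neg p)
  push_cast at h
  exact h.symm

/-- A `2`- and `3`-invariant, log-continuous function of the scale is constant on `L ≥ 1`
(density of `ℤ log 2 + ℤ log 3`). [folklore] -/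
private theorem stub_twoBaseCroft_const (Φ : ℕ → ℝ)
    (hΦ2 : ∀ L : ℕ, 1 ≤ L → Φ (2 * L) = Φ L) (hΦ3 : ∀ L : ℕ, 1 ≤ L → Φ (3 * L) = Φ L)
    (hc : ∀ ε : ℝ, 0 < ε → ∃ s : ℝ, 0 < s ∧ ∀ L L' : ℕ, 1 ≤ L → L ≤ L' →
      (L' : ℝ) ≤ (1 + s) * L → |Φ L' - Φ L| ≤ ε)
    (L L' : ℕ) (hL : 1 ≤ L) (hL' : 1 ≤ L') : Φ L = Φ L' := by
  have hinv : ∀ a b m : ℕ, 1 ≤ m → Φ (2 ^ a * 3 ^ b * m) = Φ m := by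
    intro a b m hm
    have h3m : 1 ≤ 3 ^ b * m := Nat.mul_pos (Nat.pow_pos (by norm_num)) hm
    rw [mul_assoc, stub_twoBaseCroft_iter Φ 2 (by norm_num) hΦ2 a _ h3m,
      stub_twoBaseCroft_iter Φ 3 (by norm_num) hΦ3 b m hm]
  refine eq_of_forall_dist_le fun ε hε => ?_
  obtain ⟨s, hs, hcs⟩ := hc ε hε
  have h1s : (0:ℝ) < 1 + s := by linarith
  have hlog : 0 < Real.log (1 + s) := Real.log_pos (by linarith)
  -- a point of `ℤ log 2 + ℤ log 3` in the window `(log L' - log L, log L' - log L + log (1+s))`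
  obtain ⟨g, hgD, hg1, hg2⟩ :=
    Summit.CriticalPhenomena.Ising3DConformalLimit.ExistsScaleCovariantLimitNegative.Dyadic.dense_closure_log_two_log_three.exists_between
      (show Real.log L' - Real.log L < Real.log L' - Real.log L + Real.log (1 + s) by linarith)
  obtain ⟨p, q, hpq⟩ := AddSubgroup.mem_closure_pair.1 hgD
  simp only [zsmul_eq_mul] at hpq
  obtain ⟨a, c, hp⟩ := stub_twoBaseCroft_int_split p
  obtain ⟨b, e, hq⟩ := stub_twoBaseCroft_int_split q
  -- the two comparison scales `A = 2^a 3^b L` and `B = 2^c 3^e L'`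
  have hLpos : (0:ℝ) < L := Nat.cast_pos.2 (by omega)
  have hL'pos : (0:ℝ) < L' := Nat.cast_pos.2 (by omega)
  have hApos : (0:ℝ) < (2:ℝ) ^ a * 3 ^ b * L := mul_pos (by positivity) hLpos
  have hBpos : (0:ℝ) < (2:ℝ) ^ c * 3 ^ e * L' := mul_pos (by positivity) hL'pos
  have hlogA : Real.log ((2:ℝ) ^ a * 3 ^ b * L)
      = a * Real.log 2 + b * Real.log 3 + Real.log L := by
    rw [Real.log_mul (by positivity) hLpos.ne', Real.log_mul (by positivity) (by positivity),
      Real.log_pow, Real.log_pow]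
  have hlogB : Real.log ((2:ℝ) ^ c * 3 ^ e * L')
      = c * Real.log 2 + e * Real.log 3 + Real.log L' := by
    rw [Real.log_mul (by positivity) hL'pos.ne', Real.log_mul (by positivity) (by positivity),
      Real.log_pow, Real.log_pow]
  have hdiff : Real.log ((2:ℝ) ^ a * 3 ^ b * L) - Real.log ((2:ℝ) ^ c * 3 ^ e * L')
      = g - (Real.log L' - Real.log L) := by
    rw [hlogA, hlogB, ← hpq, hp, hq]
    ring
  have hBA : (2:ℝ) ^ c * 3 ^ e * L' < (2:ℝ) ^ a * 3 ^ b * L := by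
    rw [← Real.log_lt_log_iff hBpos hApos]
    linarith
  have hAB : (2:ℝ) ^ a * 3 ^ b * L ≤ (1 + s) * ((2:ℝ) ^ c * 3 ^ e * L') := by
    rw [← Real.log_le_log_iff hApos (mul_pos h1s hBpos), Real.log_mul h1s.ne' hBpos.ne']
    linarith
  have hB1 : 1 ≤ 2 ^ c * 3 ^ e * L' :=
    Nat.mul_pos (Nat.mul_pos (Nat.pow_pos (by norm_num)) (Nat.pow_pos (by norm_num))) hL'
  have hBA' : 2 ^ c * 3 ^ e * L' ≤ 2 ^ a * 3 ^ b * L := by exact_mod_cast hBA.le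
  have hAB' : ((2 ^ a * 3 ^ b * L : ℕ) : ℝ) ≤ (1 + s) * ((2 ^ c * 3 ^ e * L' : ℕ) : ℝ) := by
    push_cast
    exact hAB
  have key := hcs (2 ^ c * 3 ^ e * L') (2 ^ a * 3 ^ b * L) hB1 hBA' hAB'
  rw [hinv a b L hL, hinv c e L' hL'] at key
  rw [Real.dist_eq]
  exact key

/-- **Stub A (two-base Croft lemma).**  A real sequence with base-uniform `2`- and `3`-tower rates
which is log-continuous at large scales converges. [folklore] -/
theorem stub_twoBaseCroft : ∀ R : ℕ → ℝ,
    (∃ C θ : ℝ, 0 < θ ∧ ∀ L : ℕ, 1 ≤ L →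
      |R (2 * L) - R L| ≤ C * (L : ℝ) ^ (-θ) ∧ |R (3 * L) - R L| ≤ C * (L : ℝ) ^ (-θ)) →
    (∀ ε : ℝ, 0 < ε → ∃ s : ℝ, 0 < s ∧ ∃ L₀ : ℕ, ∀ L L' : ℕ, L₀ ≤ L → L ≤ L' →
      (L' : ℝ) ≤ (1 + s) * L → |R L' - R L| ≤ ε) →
    ∃ M : ℝ, Tendsto R atTop (𝓝 M) := by
  intro R hrate hcont
  obtain ⟨C, θ, hθ, hCθ⟩ := hrate
  have h2 : ∀ L : ℕ, 1 ≤ L → |R (2 * L) - R L| ≤ C * (L : ℝ) ^ (-θ) :=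
    fun L hL => (hCθ L hL).1
  have h3 : ∀ L : ℕ, 1 ≤ L → |R (3 * L) - R L| ≤ C * (L : ℝ) ^ (-θ) :=
    fun L hL => (hCθ L hL).2
  have htower : ∀ L : ℕ, 1 ≤ L → ∃ a : ℝ, Tendsto (fun j : ℕ => R (2 ^ j * L)) atTop (𝓝 a) ∧
      |a - R L| ≤ C / (1 - (2:ℝ) ^ (-θ)) * (L : ℝ) ^ (-θ) :=
    fun L hL => stub_twoBaseCroft_tower R C θ hθ h2 L hL
  choose! Φ hΦt hΦb using htower
  have hΦ2 : ∀ L : ℕ, 1 ≤ L → Φ (2 * L) = Φ L := stub_twoBaseCroft_two R Φ hΦt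
  have hΦ3 : ∀ L : ℕ, 1 ≤ L → Φ (3 * L) = Φ L :=
    stub_twoBaseCroft_three R Φ C (C / (1 - (2:ℝ) ^ (-θ))) θ hθ h3 hΦb hΦ2
  have hΦc := stub_twoBaseCroft_cont R Φ hΦt hcont
  have hconst : ∀ L L' : ℕ, 1 ≤ L → 1 ≤ L' → Φ L = Φ L' :=
    stub_twoBaseCroft_const Φ hΦ2 hΦ3 hΦc
  refine ⟨Φ 1, ?_⟩
  have h0 : Tendsto (fun L : ℕ => C / (1 - (2:ℝ) ^ (-θ)) * (L : ℝ) ^ (-θ)) atTop (𝓝 0) := by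
    have h := ((tendsto_rpow_neg_atTop hθ).comp tendsto_natCast_atTop_atTop).const_mul
      (C / (1 - (2:ℝ) ^ (-θ)))
    rw [mul_zero] at h
    exact h
  rw [← tendsto_sub_nhds_zero_iff]
  refine squeeze_zero_norm' ?_ h0
  filter_upwards [eventually_ge_atTop 1] with L hL
  rw [Real.norm_eq_abs, hconst 1 L le_rfl hL, abs_sub_comm]
  exact hΦb L hL

end Summit.CriticalPhenomena.Ising3DConformalLimit.Cruxes.JoiningsTransfer.Sketch

end
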